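import Mathlib
import HarnessLib
import Literature.MathematicalPhysics.QuantumLattice.SliceCutoffGramConstant
import Summits.HubbardSuperconductivity.HubbardSuperconductivity.Theorems.KLProgrammeKLRegimeVolumeLimitSunsetFrameRate
import Summits.HubbardSuperconductivity.HubbardSuperconductivity.Theorems.KLProgrammeKLRegimeVolumeLimitSecondOrderRateSymbols

/-!
# Route `KLProgramme` — crux K3, child «VolumeLimit» (stmt-HubbardSuperconductivity-19921): the SLICED frame propagator symbol is an
# admissible symbol of the two-volume calculus — periodic, bounded by `(β/2π)/|a+½|`, torus-Lipschitz in the momentum with an explicit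
# constant `∝ Λ⁻²/|a+½|` (cell gate-hubbard-kl, seat hubbard-kl-k3c4-p1 g5; `--supports` the VolumeLimit child — the `(s)`-factors of
# VL-EXPORT-RECIPE v3 §2, one per line of every term of the engine's expansion)

The per-term two-volume calculus (`…VolumeLimitGridFamilies`, p496167: `klgf_norm_symbol_sub_le`) consumes, for every sampled factor, a
`2πℤ²`-periodic symbol with a sup-Lipschitz constant.  The lines of the scale-`(Λ, Λ′]` step carry the SLICED propagator of the frame `K`,
`S_a(x) = (χ₂((ω_a² + e_K(x)²)/Λ²) − χ₂((ω_a² + e_K(x)²)/Λ′²)) · (e_K(x) − iω_a)⁻¹` (`χ₂ = salmhoferCutoff`, `e_K = bandCT μ K`,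
`ω_a = fermiMatsubara β a`; on the grid this is `(w^K_Λ − w^K_{Λ′})(k) · (e_K(k) − iω)⁻¹` with `w = hubbardCutoffWeightCT`, the symbol of
`hubbardCovSliceCT` up to the volume normalisation `βL²`).  Under `FrameOK` (the band is `7√2`-Lipschitz, `klfr_abs_bandCT_sub_le`) and with a
Lipschitz constant `Lχ` of `χ₂` (`exists_lipschitz_salmhoferCutoff`):

* `klvs_abs_bandCT_le` — `|e_K(x)| ≤ 4 + |μ| + ‖K‖₀`;
* `klvs_abs_sliceWeight_sub_le` — `|W(e) − W(e′)| ≤ (2Lχ/Λ²)·|e² − e′²|` for the slice weight `W(e) = χ₂((ω²+e²)/Λ²) − χ₂((ω²+e²)/Λ′²)`, `0 < Λ ≤ Λ′`;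
* `klvs_sliceSymbol_periodic`, `klvs_sliceSymbol_norm_le` (`≤ (β/2π)/|a+½|`, from `|W| ≤ 1`, `abs_sliceCutoff_le_one`);
* **`klvs_sliceSymbol_sub_le`** — sup-Lipschitz: `‖S_a(x) − S_a(y)‖ ≤ 7√2·(2Lχ(4+|μ|+‖K‖₀)β/(πΛ²) + β²/(2π²))/|a+½| · ‖x − y‖_∞`;
* **`klvs_sliceSymbol_sub_le_tmod`** — the torus-Lipschitz form (`norm_sub_le_mul_tmod_of_periodic`), i.e. the hypothesis of
  `klgf_norm_symbol_sub_le` with `K_s = 7√2·(2Lχ(4+|μ|+‖K‖₀)β/(πΛ²) + β²/(2π²))/|a+½|` — summable in the Matsubara integer `a` against one more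
  `1/|·+½|` factor, `∝ Λ_n⁻²` at scale `n` (BGM 2006 (2.36): a momentum derivative of a single-scale propagator costs `γ^{−h}`… here two, crudely);
* **`klvs_norm_gridSliceSymbol_sub_le_of_frameOK`** — the same read on the grids of two volumes at labels with equal Matsubara integers:
  `‖(w_Λ − w_{Λ′})(k)·(e_K(k) − iω)⁻¹ − (w_Λ − w_{Λ′})(k′)·(e_K(k′) − iω′)⁻¹‖ ≤ K_s · Σ_i |p_k i − p′_{k′} i|_𝕋`.

Everything is proved; no definitions; nothing is asserted about the model.
-/

noncomputable section

namespace Summit.HubbardSuperconductivity.HubbardSuperconductivity.Theorems.KLRegimeSplit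

set_option linter.dupNamespace false -- summit = problem name (single-conjunct summit), D-0017

open Finset Literature.MathematicalPhysics.QuantumLattice Literature.Probability.LatticeModels
open Summit.HubbardSuperconductivity.HubbardSuperconductivity.Theorems.KLProgrammeLegKernels
open Summit.HubbardSuperconductivity.HubbardSuperconductivity.Theorems.TwoPointAssembly

/-! ## §1 The band and the slice weight -/

/-- **`|e_K(x)| ≤ 4 + |μ| + ‖K‖₀`** (`e_K = −2(cos x₀ + cos x₁) − μ − K(x)`). -/
theorem klvs_abs_bandCT_le (μ : ℝ) (K : TrigPolyC4v) (x : Fin 2 → ℝ) : |bandCT μ K x| ≤ 4 + |μ| + K.coeffNorm 0 := by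
  have hcos : |∑ i : Fin 2, Real.cos (x i)| ≤ 2 := by
    calc |∑ i : Fin 2, Real.cos (x i)| ≤ ∑ i : Fin 2, |Real.cos (x i)| := Finset.abs_sum_le_sum_abs _ _
      _ ≤ ∑ _i : Fin 2, (1 : ℝ) := Finset.sum_le_sum fun i _ => Real.abs_cos_le_one _
      _ = 2 := by simp
  have hK := TrigPolyC4v.abs_eval_le_coeffNorm K x
  rw [bandCT]
  calc |-2 * ∑ i, Real.cos (x i) - μ - K.eval x| ≤ |-2 * ∑ i, Real.cos (x i) - μ| + |K.eval x| := abs_sub _ _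
    _ ≤ (|-2 * ∑ i, Real.cos (x i)| + |μ|) + K.coeffNorm 0 := add_le_add (abs_sub _ _) hK
    _ ≤ (4 + |μ|) + K.coeffNorm 0 := by
        gcongr
        rw [abs_mul]
        calc |(-2 : ℝ)| * |∑ i, Real.cos (x i)| ≤ 2 * 2 := by
              rw [abs_neg, abs_two]; exact mul_le_mul_of_nonneg_left hcos (by norm_num)
          _ = 4 := by norm_num
    _ = 4 + |μ| + K.coeffNorm 0 := by ring

/-- **The slice weight is Lipschitz in the band value**: for `0 < Λ ≤ Λ′` and a Lipschitz constant `Lχ` of `χ₂`,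
`|W(e) − W(e′)| ≤ (2Lχ/Λ²)·|e² − e′²|`, `W(e) = χ₂((ω²+e²)/Λ²) − χ₂((ω²+e²)/Λ′²)`. -/
theorem klvs_abs_sliceWeight_sub_le {Lχ : ℝ} (hLχ : ∀ s t : ℝ, |salmhoferCutoff s - salmhoferCutoff t| ≤ Lχ * |s - t|) (hL0 : 0 ≤ Lχ)
    {Λ Λ' : ℝ} (hΛ : 0 < Λ) (hΛΛ' : Λ ≤ Λ') (ω e e' : ℝ) :
    |(salmhoferCutoff ((ω ^ 2 + e ^ 2) / Λ ^ 2) - salmhoferCutoff ((ω ^ 2 + e ^ 2) / Λ' ^ 2)) -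
        (salmhoferCutoff ((ω ^ 2 + e' ^ 2) / Λ ^ 2) - salmhoferCutoff ((ω ^ 2 + e' ^ 2) / Λ' ^ 2))| ≤
      2 * Lχ / Λ ^ 2 * |e ^ 2 - e' ^ 2| := by
  have hΛ2 : 0 < Λ ^ 2 := by positivity
  have hΛ'2 : Λ ^ 2 ≤ Λ' ^ 2 := pow_le_pow_left₀ hΛ.le hΛΛ' 2
  have hΛ'pos : 0 < Λ' ^ 2 := lt_of_lt_of_le hΛ2 hΛ'2
  have h1 := hLχ ((ω ^ 2 + e ^ 2) / Λ ^ 2) ((ω ^ 2 + e' ^ 2) / Λ ^ 2)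
  have h2 := hLχ ((ω ^ 2 + e ^ 2) / Λ' ^ 2) ((ω ^ 2 + e' ^ 2) / Λ' ^ 2)
  have hd1 : |(ω ^ 2 + e ^ 2) / Λ ^ 2 - (ω ^ 2 + e' ^ 2) / Λ ^ 2| = |e ^ 2 - e' ^ 2| / Λ ^ 2 := by
    rw [← sub_div, abs_div, abs_of_pos hΛ2]; congr 1; ring_nf
  have hd2 : |(ω ^ 2 + e ^ 2) / Λ' ^ 2 - (ω ^ 2 + e' ^ 2) / Λ' ^ 2| = |e ^ 2 - e' ^ 2| / Λ' ^ 2 := by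
    rw [← sub_div, abs_div, abs_of_pos hΛ'pos]; congr 1; ring_nf
  rw [hd1] at h1
  rw [hd2] at h2
  have h2' : Lχ * (|e ^ 2 - e' ^ 2| / Λ' ^ 2) ≤ Lχ * (|e ^ 2 - e' ^ 2| / Λ ^ 2) :=
    mul_le_mul_of_nonneg_left (div_le_div_of_nonneg_left (abs_nonneg _) hΛ2 hΛ'2) hL0
  calc _ = |(salmhoferCutoff ((ω ^ 2 + e ^ 2) / Λ ^ 2) - salmhoferCutoff ((ω ^ 2 + e' ^ 2) / Λ ^ 2)) -
          (salmhoferCutoff ((ω ^ 2 + e ^ 2) / Λ' ^ 2) - salmhoferCutoff ((ω ^ 2 + e' ^ 2) / Λ' ^ 2))| := by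
        congr 1; ring
    _ ≤ |salmhoferCutoff ((ω ^ 2 + e ^ 2) / Λ ^ 2) - salmhoferCutoff ((ω ^ 2 + e' ^ 2) / Λ ^ 2)| +
          |salmhoferCutoff ((ω ^ 2 + e ^ 2) / Λ' ^ 2) - salmhoferCutoff ((ω ^ 2 + e' ^ 2) / Λ' ^ 2)| := abs_sub _ _
    _ ≤ Lχ * (|e ^ 2 - e' ^ 2| / Λ ^ 2) + Lχ * (|e ^ 2 - e' ^ 2| / Λ ^ 2) := add_le_add h1 (h2.trans h2')
    _ = 2 * Lχ / Λ ^ 2 * |e ^ 2 - e' ^ 2| := by ring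

/-- `|e² − e′²| ≤ 2E·|e − e′|` when `|e|, |e′| ≤ E`. -/
theorem klvs_abs_sq_sub_sq_le {e e' E : ℝ} (he : |e| ≤ E) (he' : |e'| ≤ E) : |e ^ 2 - e' ^ 2| ≤ 2 * E * |e - e'| := by
  rw [sq_sub_sq, abs_mul]
  refine mul_le_mul_of_nonneg_right ?_ (abs_nonneg _)
  calc |e + e'| ≤ |e| + |e'| := abs_add_le _ _
    _ ≤ E + E := add_le_add he he'
    _ = 2 * E := by ring

/-! ## §2 The sliced frame symbol: periodicity, size, sup-Lipschitz modulus -/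

section Frame

variable {R : RenConsts} {U : ℝ} {N : ℕ} {μ : ℝ} {K : TrigPolyC4v}

/-- Periodicity of the sliced symbol in the momentum (`p + m·2π` convention). -/
theorem klvs_sliceSymbol_periodic (β μ : ℝ) (K : TrigPolyC4v) (Λ Λ' : ℝ) (a : ℤ) (x : Fin 2 → ℝ) (m : Fin 2 → ℤ) :
    ((salmhoferCutoff ((fermiMatsubara β a ^ 2 + bandCT μ K (fun i => x i + m i * (2 * Real.pi)) ^ 2) / Λ ^ 2) -
          salmhoferCutoff ((fermiMatsubara β a ^ 2 + bandCT μ K (fun i => x i + m i * (2 * Real.pi)) ^ 2) / Λ' ^ 2) : ℝ) : ℂ) *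
        ((bandCT μ K (fun i => x i + m i * (2 * Real.pi)) : ℂ) - Complex.I * (fermiMatsubara β a : ℂ))⁻¹ =
      ((salmhoferCutoff ((fermiMatsubara β a ^ 2 + bandCT μ K x ^ 2) / Λ ^ 2) -
          salmhoferCutoff ((fermiMatsubara β a ^ 2 + bandCT μ K x ^ 2) / Λ' ^ 2) : ℝ) : ℂ) *
        ((bandCT μ K x : ℂ) - Complex.I * (fermiMatsubara β a : ℂ))⁻¹ := by
  rw [klso_bandCT_periodic']

/-- **Size**: `‖S_a(x)‖ ≤ (β/2π)/|a+½|` (`|W| ≤ 1`, `‖(e_K − iω_a)⁻¹‖ ≤ (β/2π)/|a+½|`). -/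
theorem klvs_sliceSymbol_norm_le {β : ℝ} (hβ : 0 < β) (μ : ℝ) (K : TrigPolyC4v) (Λ Λ' : ℝ) (a : ℤ) (x : Fin 2 → ℝ) :
    ‖((salmhoferCutoff ((fermiMatsubara β a ^ 2 + bandCT μ K x ^ 2) / Λ ^ 2) -
          salmhoferCutoff ((fermiMatsubara β a ^ 2 + bandCT μ K x ^ 2) / Λ' ^ 2) : ℝ) : ℂ) *
        ((bandCT μ K x : ℂ) - Complex.I * (fermiMatsubara β a : ℂ))⁻¹‖ ≤ β / (2 * Real.pi) / |(a : ℝ) + 1 / 2| := by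
  rw [norm_mul, Complex.norm_real, Real.norm_eq_abs]
  have hW := abs_sliceCutoff_le_one (fermiMatsubara β a ^ 2 + bandCT μ K x ^ 2) Λ Λ'
  have hg := klfs_frameSymbol_norm_le hβ μ K a x
  calc _ ≤ 1 * (β / (2 * Real.pi) / |(a : ℝ) + 1 / 2|) := mul_le_mul hW hg (norm_nonneg _) zero_le_one
    _ = _ := one_mul _

/-- **Sup-Lipschitz modulus of the sliced frame symbol** under `FrameOK`, `0 < Λ ≤ Λ′`, `χ₂` `Lχ`-Lipschitz:
`‖S_a(x) − S_a(y)‖ ≤ 7√2·(2Lχ(4+|μ|+‖K‖₀)β/(πΛ²) + β²/(2π²))/|a+½| · ‖x − y‖_∞`. -/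
theorem klvs_sliceSymbol_sub_le {β : ℝ} (hβ : 0 < β) (hK : FrameOK R U N μ K) {Lχ : ℝ}
    (hLχ : ∀ s t : ℝ, |salmhoferCutoff s - salmhoferCutoff t| ≤ Lχ * |s - t|) (hL0 : 0 ≤ Lχ) {Λ Λ' : ℝ} (hΛ : 0 < Λ) (hΛΛ' : Λ ≤ Λ')
    (a : ℤ) (x y : Fin 2 → ℝ) :
    ‖((salmhoferCutoff ((fermiMatsubara β a ^ 2 + bandCT μ K x ^ 2) / Λ ^ 2) -
            salmhoferCutoff ((fermiMatsubara β a ^ 2 + bandCT μ K x ^ 2) / Λ' ^ 2) : ℝ) : ℂ) *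
          ((bandCT μ K x : ℂ) - Complex.I * (fermiMatsubara β a : ℂ))⁻¹ -
        ((salmhoferCutoff ((fermiMatsubara β a ^ 2 + bandCT μ K y ^ 2) / Λ ^ 2) -
            salmhoferCutoff ((fermiMatsubara β a ^ 2 + bandCT μ K y ^ 2) / Λ' ^ 2) : ℝ) : ℂ) *
          ((bandCT μ K y : ℂ) - Complex.I * (fermiMatsubara β a : ℂ))⁻¹‖ ≤
      7 * Real.sqrt 2 * (2 * Lχ * (4 + |μ| + K.coeffNorm 0) * β / (Real.pi * Λ ^ 2) + β ^ 2 / (2 * Real.pi ^ 2)) /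
          |(a : ℝ) + 1 / 2| * ‖x - y‖ := by
  set E : ℝ := 4 + |μ| + K.coeffNorm 0 with hE
  set Wx : ℝ := salmhoferCutoff ((fermiMatsubara β a ^ 2 + bandCT μ K x ^ 2) / Λ ^ 2) -
    salmhoferCutoff ((fermiMatsubara β a ^ 2 + bandCT μ K x ^ 2) / Λ' ^ 2) with hWx
  set Wy : ℝ := salmhoferCutoff ((fermiMatsubara β a ^ 2 + bandCT μ K y ^ 2) / Λ ^ 2) -
    salmhoferCutoff ((fermiMatsubara β a ^ 2 + bandCT μ K y ^ 2) / Λ' ^ 2) with hWy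
  set gx : ℂ := ((bandCT μ K x : ℂ) - Complex.I * (fermiMatsubara β a : ℂ))⁻¹ with hgx
  set gy : ℂ := ((bandCT μ K y : ℂ) - Complex.I * (fermiMatsubara β a : ℂ))⁻¹ with hgy
  have ha := klsf_abs_add_half_pos a
  have hE0 : 0 ≤ E := by
    have := TrigPolyC4v.coeffNorm_nonneg 0 K
    rw [hE]; positivity
  have hex : |bandCT μ K x| ≤ E := klvs_abs_bandCT_le μ K x
  have hey : |bandCT μ K y| ≤ E := klvs_abs_bandCT_le μ K y
  -- the four estimates
  have hW : |Wx - Wy| ≤ 2 * Lχ / Λ ^ 2 * (2 * E * (7 * Real.sqrt 2 * ‖x - y‖)) := by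
    have h1 := klvs_abs_sliceWeight_sub_le hLχ hL0 hΛ hΛΛ' (fermiMatsubara β a) (bandCT μ K x) (bandCT μ K y)
    refine h1.trans (mul_le_mul_of_nonneg_left ?_ (by positivity))
    exact (klvs_abs_sq_sub_sq_le hex hey).trans (mul_le_mul_of_nonneg_left (klfr_abs_bandCT_sub_le hK x y) (by positivity))
  have hWy1 : |Wy| ≤ 1 := abs_sliceCutoff_le_one _ Λ Λ'
  have hgxn : ‖gx‖ ≤ β / (2 * Real.pi) / |(a : ℝ) + 1 / 2| := klfs_frameSymbol_norm_le hβ μ K a x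
  have hgxy : ‖gx - gy‖ ≤ 7 * Real.sqrt 2 * β ^ 2 / (2 * Real.pi ^ 2) / |(a : ℝ) + 1 / 2| * ‖x - y‖ :=
    klfr_frameSymbol_sub_le hβ hK a x y
  have hsplit : (Wx : ℂ) * gx - (Wy : ℂ) * gy = ((Wx : ℂ) - (Wy : ℂ)) * gx + (Wy : ℂ) * (gx - gy) := by ring
  rw [hsplit]
  calc ‖((Wx : ℂ) - (Wy : ℂ)) * gx + (Wy : ℂ) * (gx - gy)‖
      ≤ ‖((Wx : ℂ) - (Wy : ℂ)) * gx‖ + ‖(Wy : ℂ) * (gx - gy)‖ := norm_add_le _ _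
    _ = |Wx - Wy| * ‖gx‖ + |Wy| * ‖gx - gy‖ := by
        rw [norm_mul, norm_mul, ← Complex.ofReal_sub, Complex.norm_real, Complex.norm_real, Real.norm_eq_abs, Real.norm_eq_abs]
    _ ≤ 2 * Lχ / Λ ^ 2 * (2 * E * (7 * Real.sqrt 2 * ‖x - y‖)) * (β / (2 * Real.pi) / |(a : ℝ) + 1 / 2|) +
          1 * (7 * Real.sqrt 2 * β ^ 2 / (2 * Real.pi ^ 2) / |(a : ℝ) + 1 / 2| * ‖x - y‖) :=
        add_le_add (mul_le_mul hW hgxn (norm_nonneg _) (by positivity)) (mul_le_mul hWy1 hgxy (norm_nonneg _) zero_le_one)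
    _ = 7 * Real.sqrt 2 * (2 * Lχ * E * β / (Real.pi * Λ ^ 2) + β ^ 2 / (2 * Real.pi ^ 2)) / |(a : ℝ) + 1 / 2| * ‖x - y‖ := by
        field_simp

/-- **Torus-Lipschitz form** (the hypothesis of `klgf_norm_symbol_sub_le`): the same bound with `Σ_i |x_i − y_i|_𝕋` in place of `‖x − y‖_∞`
(periodicity + `norm_sub_le_mul_tmod_of_periodic`). -/
theorem klvs_sliceSymbol_sub_le_tmod {β : ℝ} (hβ : 0 < β) (hK : FrameOK R U N μ K) {Lχ : ℝ}
    (hLχ : ∀ s t : ℝ, |salmhoferCutoff s - salmhoferCutoff t| ≤ Lχ * |s - t|) (hL0 : 0 ≤ Lχ) {Λ Λ' : ℝ} (hΛ : 0 < Λ) (hΛΛ' : Λ ≤ Λ')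
    (a : ℤ) (x y : Fin 2 → ℝ) :
    ‖((salmhoferCutoff ((fermiMatsubara β a ^ 2 + bandCT μ K x ^ 2) / Λ ^ 2) -
            salmhoferCutoff ((fermiMatsubara β a ^ 2 + bandCT μ K x ^ 2) / Λ' ^ 2) : ℝ) : ℂ) *
          ((bandCT μ K x : ℂ) - Complex.I * (fermiMatsubara β a : ℂ))⁻¹ -
        ((salmhoferCutoff ((fermiMatsubara β a ^ 2 + bandCT μ K y ^ 2) / Λ ^ 2) -
            salmhoferCutoff ((fermiMatsubara β a ^ 2 + bandCT μ K y ^ 2) / Λ' ^ 2) : ℝ) : ℂ) *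
          ((bandCT μ K y : ℂ) - Complex.I * (fermiMatsubara β a : ℂ))⁻¹‖ ≤
      7 * Real.sqrt 2 * (2 * Lχ * (4 + |μ| + K.coeffNorm 0) * β / (Real.pi * Λ ^ 2) + β ^ 2 / (2 * Real.pi ^ 2)) /
          |(a : ℝ) + 1 / 2| * ∑ i, torusAbs (x i - y i) := by
  have ha := klsf_abs_add_half_pos a
  have hK0 := TrigPolyC4v.coeffNorm_nonneg 0 K
  exact norm_sub_le_mul_tmod_of_periodic
    (f := fun z : Fin 2 → ℝ => ((salmhoferCutoff ((fermiMatsubara β a ^ 2 + bandCT μ K z ^ 2) / Λ ^ 2) -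
            salmhoferCutoff ((fermiMatsubara β a ^ 2 + bandCT μ K z ^ 2) / Λ' ^ 2) : ℝ) : ℂ) *
          ((bandCT μ K z : ℂ) - Complex.I * (fermiMatsubara β a : ℂ))⁻¹)
    (by positivity) (fun p m => klvs_sliceSymbol_periodic β μ K Λ Λ' a p m)
    (fun p q => klvs_sliceSymbol_sub_le hβ hK hLχ hL0 hΛ hΛΛ' a p q) x y

/-- **On the grids of two volumes, at labels with equal Matsubara integers**: with `w^K_Λ = hubbardCutoffWeightCT … K Λ` and
`e_K = nambuXiCT`, for `k ∈ (ℤ/L)²`, `k′ ∈ (ℤ/L′)²`, `matsubaraInt M ω = matsubaraInt M′ ω′ = a`,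
`‖(w_Λ − w_{Λ′})(ω,k)·(e_K(k) − iω)⁻¹ − (w_Λ − w_{Λ′})(ω′,k′)·(e_K(k′) − iω′)⁻¹‖ ≤ K_s(a) · Σ_i |p_k i − p′_{k′} i|_𝕋` — the sliced lines of the
scale-`(Λ,Λ′]` step are comparable across volumes with `ρ = 0` and modulus constant `K_s(a)`. -/
theorem klvs_norm_gridSliceSymbol_sub_le_of_frameOK {L L' M M' : ℕ} [NeZero L] [NeZero L'] {β : ℝ} (hβ : 0 < β)
    (hK : FrameOK R U N μ K) {Lχ : ℝ} (hLχ : ∀ s t : ℝ, |salmhoferCutoff s - salmhoferCutoff t| ≤ Lχ * |s - t|) (hL0 : 0 ≤ Lχ)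
    {Λ Λ' : ℝ} (hΛ : 0 < Λ) (hΛΛ' : Λ ≤ Λ') {ω : MatsubaraIdx M} {ω' : MatsubaraIdx M'} (hωω' : matsubaraInt M ω = matsubaraInt M' ω')
    (k : TorusSite 2 L) (k' : TorusSite 2 L') :
    ‖((hubbardCutoffWeightCT L M β μ K Λ (ω, k) - hubbardCutoffWeightCT L M β μ K Λ' (ω, k) : ℝ) : ℂ) *
          ((nambuXiCT L μ K k : ℂ) - Complex.I * (matsubaraFreq β M ω : ℂ))⁻¹ -
        ((hubbardCutoffWeightCT L' M' β μ K Λ (ω', k') - hubbardCutoffWeightCT L' M' β μ K Λ' (ω', k') : ℝ) : ℂ) *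
          ((nambuXiCT L' μ K k' : ℂ) - Complex.I * (matsubaraFreq β M' ω' : ℂ))⁻¹‖ ≤
      7 * Real.sqrt 2 * (2 * Lχ * (4 + |μ| + K.coeffNorm 0) * β / (Real.pi * Λ ^ 2) + β ^ 2 / (2 * Real.pi ^ 2)) /
          |((matsubaraInt M ω : ℤ) : ℝ) + 1 / 2| * ∑ i, torusAbs (latticeMomentum L k i - latticeMomentum L' k' i) := by
  have h := klvs_sliceSymbol_sub_le_tmod hβ hK hLχ hL0 hΛ hΛΛ' (matsubaraInt M ω) (latticeMomentum L k) (latticeMomentum L' k')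
  simp only [hubbardCutoffWeightCT, matsubaraFreq_eq_fermiMatsubara, nambuXiCT_eq_bandCT, ← hωω']
  simpa only [nambuXiCT_eq_bandCT] using h

/-! ## §3 (appended, g5) Any Lipschitz weight of `ω² + e_K²`: the HARD (`1 − χ₂(·/Λ²)`) and SOFT (`χ₂(·/Λ²)`) covariances too

The three line types of the engine's step (`contr_klHardCov / klSliceCov / klSoftCov`, p495694) carry the weights `1 − w_Λ`, `w_Λ − w_{Λ′}`,
`w_Λ` of the same frame symbol.  One lemma covers them all: for ANY weight `φ : ℝ → ℝ` with `|φ| ≤ 1` and `|φ s − φ t| ≤ Lφ|s − t|`, the symbol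
`φ(ω_a² + e_K(x)²)·(e_K(x) − iω_a)⁻¹` is sup-Lipschitz with constant `7√2·(Lφ(4+|μ|+‖K‖₀)β/π + β²/(2π²))/|a+½|` (slice: `Lφ = 2Lχ/Λ²`, hard:
`Lφ = Lχ/Λ²`, soft: `Lφ = Lχ/Λ²`). -/

/-- **Weighted frame symbol, sup-Lipschitz** under `FrameOK`: `|φ| ≤ 1`, `φ` `Lφ`-Lipschitz (`0 ≤ Lφ`) ⇒
`‖φ(ω_a²+e_K(x)²)·g_a(x) − φ(ω_a²+e_K(y)²)·g_a(y)‖ ≤ 7√2·(Lφ(4+|μ|+‖K‖₀)β/π + β²/(2π²))/|a+½| · ‖x − y‖_∞`. -/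
theorem klvs_weightedSymbol_sub_le {β : ℝ} (hβ : 0 < β) (hK : FrameOK R U N μ K) {φ : ℝ → ℝ} {Lφ : ℝ}
    (hφ1 : ∀ s, |φ s| ≤ 1) (hφL : ∀ s t : ℝ, |φ s - φ t| ≤ Lφ * |s - t|) (hL0 : 0 ≤ Lφ) (a : ℤ) (x y : Fin 2 → ℝ) :
    ‖((φ (fermiMatsubara β a ^ 2 + bandCT μ K x ^ 2) : ℝ) : ℂ) * ((bandCT μ K x : ℂ) - Complex.I * (fermiMatsubara β a : ℂ))⁻¹ -
        ((φ (fermiMatsubara β a ^ 2 + bandCT μ K y ^ 2) : ℝ) : ℂ) * ((bandCT μ K y : ℂ) - Complex.I * (fermiMatsubara β a : ℂ))⁻¹‖ ≤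
      7 * Real.sqrt 2 * (Lφ * (4 + |μ| + K.coeffNorm 0) * β / Real.pi + β ^ 2 / (2 * Real.pi ^ 2)) / |(a : ℝ) + 1 / 2| * ‖x - y‖ := by
  set E : ℝ := 4 + |μ| + K.coeffNorm 0 with hE
  set Wx : ℝ := φ (fermiMatsubara β a ^ 2 + bandCT μ K x ^ 2) with hWx
  set Wy : ℝ := φ (fermiMatsubara β a ^ 2 + bandCT μ K y ^ 2) with hWy
  set gx : ℂ := ((bandCT μ K x : ℂ) - Complex.I * (fermiMatsubara β a : ℂ))⁻¹ with hgx
  set gy : ℂ := ((bandCT μ K y : ℂ) - Complex.I * (fermiMatsubara β a : ℂ))⁻¹ with hgy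
  have ha := klsf_abs_add_half_pos a
  have hE0 : 0 ≤ E := by
    have := TrigPolyC4v.coeffNorm_nonneg 0 K
    rw [hE]; positivity
  have hex : |bandCT μ K x| ≤ E := klvs_abs_bandCT_le μ K x
  have hey : |bandCT μ K y| ≤ E := klvs_abs_bandCT_le μ K y
  have hW : |Wx - Wy| ≤ Lφ * (2 * E * (7 * Real.sqrt 2 * ‖x - y‖)) := by
    have h1 := hφL (fermiMatsubara β a ^ 2 + bandCT μ K x ^ 2) (fermiMatsubara β a ^ 2 + bandCT μ K y ^ 2)
    have hd : |fermiMatsubara β a ^ 2 + bandCT μ K x ^ 2 - (fermiMatsubara β a ^ 2 + bandCT μ K y ^ 2)| =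
        |bandCT μ K x ^ 2 - bandCT μ K y ^ 2| := by congr 1; ring
    rw [hd] at h1
    refine h1.trans (mul_le_mul_of_nonneg_left ?_ hL0)
    exact (klvs_abs_sq_sub_sq_le hex hey).trans (mul_le_mul_of_nonneg_left (klfr_abs_bandCT_sub_le hK x y) (by positivity))
  have hWy1 : |Wy| ≤ 1 := hφ1 _
  have hgxn : ‖gx‖ ≤ β / (2 * Real.pi) / |(a : ℝ) + 1 / 2| := klfs_frameSymbol_norm_le hβ μ K a x
  have hgxy : ‖gx - gy‖ ≤ 7 * Real.sqrt 2 * β ^ 2 / (2 * Real.pi ^ 2) / |(a : ℝ) + 1 / 2| * ‖x - y‖ :=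
    klfr_frameSymbol_sub_le hβ hK a x y
  have hsplit : (Wx : ℂ) * gx - (Wy : ℂ) * gy = ((Wx : ℂ) - (Wy : ℂ)) * gx + (Wy : ℂ) * (gx - gy) := by ring
  rw [hsplit]
  calc ‖((Wx : ℂ) - (Wy : ℂ)) * gx + (Wy : ℂ) * (gx - gy)‖
      ≤ ‖((Wx : ℂ) - (Wy : ℂ)) * gx‖ + ‖(Wy : ℂ) * (gx - gy)‖ := norm_add_le _ _
    _ = |Wx - Wy| * ‖gx‖ + |Wy| * ‖gx - gy‖ := by
        rw [norm_mul, norm_mul, ← Complex.ofReal_sub, Complex.norm_real, Complex.norm_real, Real.norm_eq_abs, Real.norm_eq_abs]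
    _ ≤ Lφ * (2 * E * (7 * Real.sqrt 2 * ‖x - y‖)) * (β / (2 * Real.pi) / |(a : ℝ) + 1 / 2|) +
          1 * (7 * Real.sqrt 2 * β ^ 2 / (2 * Real.pi ^ 2) / |(a : ℝ) + 1 / 2| * ‖x - y‖) :=
        add_le_add (mul_le_mul hW hgxn (norm_nonneg _) (by positivity)) (mul_le_mul hWy1 hgxy (norm_nonneg _) zero_le_one)
    _ = 7 * Real.sqrt 2 * (Lφ * E * β / Real.pi + β ^ 2 / (2 * Real.pi ^ 2)) / |(a : ℝ) + 1 / 2| * ‖x - y‖ := by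
        field_simp

/-- **Weighted frame symbol, torus-Lipschitz form** (hypothesis shape of `klgf_norm_symbol_sub_le`). -/
theorem klvs_weightedSymbol_sub_le_tmod {β : ℝ} (hβ : 0 < β) (hK : FrameOK R U N μ K) {φ : ℝ → ℝ} {Lφ : ℝ}
    (hφ1 : ∀ s, |φ s| ≤ 1) (hφL : ∀ s t : ℝ, |φ s - φ t| ≤ Lφ * |s - t|) (hL0 : 0 ≤ Lφ) (a : ℤ) (x y : Fin 2 → ℝ) :
    ‖((φ (fermiMatsubara β a ^ 2 + bandCT μ K x ^ 2) : ℝ) : ℂ) * ((bandCT μ K x : ℂ) - Complex.I * (fermiMatsubara β a : ℂ))⁻¹ -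
        ((φ (fermiMatsubara β a ^ 2 + bandCT μ K y ^ 2) : ℝ) : ℂ) * ((bandCT μ K y : ℂ) - Complex.I * (fermiMatsubara β a : ℂ))⁻¹‖ ≤
      7 * Real.sqrt 2 * (Lφ * (4 + |μ| + K.coeffNorm 0) * β / Real.pi + β ^ 2 / (2 * Real.pi ^ 2)) / |(a : ℝ) + 1 / 2| *
        ∑ i, torusAbs (x i - y i) := by
  have ha := klsf_abs_add_half_pos a
  have hK0 := TrigPolyC4v.coeffNorm_nonneg 0 K
  exact norm_sub_le_mul_tmod_of_periodic
    (f := fun z : Fin 2 → ℝ => ((φ (fermiMatsubara β a ^ 2 + bandCT μ K z ^ 2) : ℝ) : ℂ) *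
      ((bandCT μ K z : ℂ) - Complex.I * (fermiMatsubara β a : ℂ))⁻¹)
    (by positivity) (fun p m => by simp only [klso_bandCT_periodic'])
    (fun p q => klvs_weightedSymbol_sub_le hβ hK hφ1 hφL hL0 a p q) x y

/-- The SOFT weight `χ₂(s/Λ²)` is bounded by `1` and `Lχ/Λ²`-Lipschitz. -/
theorem klvs_softWeight_lipschitz {Lχ : ℝ} (hLχ : ∀ s t : ℝ, |salmhoferCutoff s - salmhoferCutoff t| ≤ Lχ * |s - t|) {Λ : ℝ}
    (hΛ : 0 < Λ) (s t : ℝ) : |salmhoferCutoff (s / Λ ^ 2) - salmhoferCutoff (t / Λ ^ 2)| ≤ Lχ / Λ ^ 2 * |s - t| := by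
  have hΛ2 : 0 < Λ ^ 2 := by positivity
  have h := hLχ (s / Λ ^ 2) (t / Λ ^ 2)
  rw [← sub_div, abs_div, abs_of_pos hΛ2] at h
  calc _ ≤ Lχ * (|s - t| / Λ ^ 2) := h
    _ = Lχ / Λ ^ 2 * |s - t| := by ring

/-- `|χ₂| ≤ 1`. -/
theorem klvs_abs_salmhoferCutoff_le_one (s : ℝ) : |salmhoferCutoff s| ≤ 1 := by
  have h := salmhoferCutoff_mem_Icc s
  rw [abs_le]; constructor <;> linarith [h.1, h.2]

/-- The HARD weight `1 − χ₂(s/Λ²)` is bounded by `1` and `Lχ/Λ²`-Lipschitz. -/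
theorem klvs_hardWeight_lipschitz {Lχ : ℝ} (hLχ : ∀ s t : ℝ, |salmhoferCutoff s - salmhoferCutoff t| ≤ Lχ * |s - t|) {Λ : ℝ}
    (hΛ : 0 < Λ) (s t : ℝ) :
    |(1 - salmhoferCutoff (s / Λ ^ 2)) - (1 - salmhoferCutoff (t / Λ ^ 2))| ≤ Lχ / Λ ^ 2 * |s - t| := by
  rw [show (1 - salmhoferCutoff (s / Λ ^ 2)) - (1 - salmhoferCutoff (t / Λ ^ 2)) =
    -(salmhoferCutoff (s / Λ ^ 2) - salmhoferCutoff (t / Λ ^ 2)) by ring, abs_neg]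
  exact klvs_softWeight_lipschitz hLχ hΛ s t

/-- `|1 − χ₂| ≤ 1`. -/
theorem klvs_abs_one_sub_salmhoferCutoff_le_one (s : ℝ) : |1 - salmhoferCutoff s| ≤ 1 := by
  have h := salmhoferCutoff_mem_Icc s
  rw [abs_le]; constructor <;> linarith [h.1, h.2]

/-- **The SOFT (below-`Λ`) covariance symbol `w_Λ·(e_K − iω)⁻¹` is torus-Lipschitz** with
`K_soft(a) = 7√2·(Lχ(4+|μ|+‖K‖₀)β/(πΛ²) + β²/(2π²))/|a+½|`. -/
theorem klvs_softSymbol_sub_le_tmod {β : ℝ} (hβ : 0 < β) (hK : FrameOK R U N μ K) {Lχ : ℝ}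
    (hLχ : ∀ s t : ℝ, |salmhoferCutoff s - salmhoferCutoff t| ≤ Lχ * |s - t|) (hL0 : 0 ≤ Lχ) {Λ : ℝ} (hΛ : 0 < Λ)
    (a : ℤ) (x y : Fin 2 → ℝ) :
    ‖((salmhoferCutoff ((fermiMatsubara β a ^ 2 + bandCT μ K x ^ 2) / Λ ^ 2) : ℝ) : ℂ) *
          ((bandCT μ K x : ℂ) - Complex.I * (fermiMatsubara β a : ℂ))⁻¹ -
        ((salmhoferCutoff ((fermiMatsubara β a ^ 2 + bandCT μ K y ^ 2) / Λ ^ 2) : ℝ) : ℂ) *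
          ((bandCT μ K y : ℂ) - Complex.I * (fermiMatsubara β a : ℂ))⁻¹‖ ≤
      7 * Real.sqrt 2 * (Lχ / Λ ^ 2 * (4 + |μ| + K.coeffNorm 0) * β / Real.pi + β ^ 2 / (2 * Real.pi ^ 2)) / |(a : ℝ) + 1 / 2| *
        ∑ i, torusAbs (x i - y i) :=
  klvs_weightedSymbol_sub_le_tmod hβ hK (φ := fun s => salmhoferCutoff (s / Λ ^ 2)) (fun s => klvs_abs_salmhoferCutoff_le_one _)
    (fun s t => klvs_softWeight_lipschitz hLχ hΛ s t) (by positivity) a x y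

/-- **The HARD (above-`Λ`) covariance symbol `(1 − w_Λ)·(e_K − iω)⁻¹` is torus-Lipschitz** with the same constant `K_soft(a)`. -/
theorem klvs_hardSymbol_sub_le_tmod {β : ℝ} (hβ : 0 < β) (hK : FrameOK R U N μ K) {Lχ : ℝ}
    (hLχ : ∀ s t : ℝ, |salmhoferCutoff s - salmhoferCutoff t| ≤ Lχ * |s - t|) (hL0 : 0 ≤ Lχ) {Λ : ℝ} (hΛ : 0 < Λ)
    (a : ℤ) (x y : Fin 2 → ℝ) :
    ‖(((1 - salmhoferCutoff ((fermiMatsubara β a ^ 2 + bandCT μ K x ^ 2) / Λ ^ 2)) : ℝ) : ℂ) *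
          ((bandCT μ K x : ℂ) - Complex.I * (fermiMatsubara β a : ℂ))⁻¹ -
        (((1 - salmhoferCutoff ((fermiMatsubara β a ^ 2 + bandCT μ K y ^ 2) / Λ ^ 2)) : ℝ) : ℂ) *
          ((bandCT μ K y : ℂ) - Complex.I * (fermiMatsubara β a : ℂ))⁻¹‖ ≤
      7 * Real.sqrt 2 * (Lχ / Λ ^ 2 * (4 + |μ| + K.coeffNorm 0) * β / Real.pi + β ^ 2 / (2 * Real.pi ^ 2)) / |(a : ℝ) + 1 / 2| *
        ∑ i, torusAbs (x i - y i) :=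
  klvs_weightedSymbol_sub_le_tmod hβ hK (φ := fun s => 1 - salmhoferCutoff (s / Λ ^ 2))
    (fun s => klvs_abs_one_sub_salmhoferCutoff_le_one _) (fun s t => klvs_hardWeight_lipschitz hLχ hΛ s t) (by positivity) a x y

end Frame

end Summit.HubbardSuperconductivity.HubbardSuperconductivity.Theorems.KLRegimeSplit

end
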